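import Summits.QuantumAdvantage.QuantumAdvantage.Theorems.OrbitAveragingA

/-! # OrbitAveragingB — part 2/5 (mechanical split for landing of `OrbitAveraging`; content verbatim; scopes re-opened with their variables) -/

set_option linter.dupNamespace false
set_option linter.style.longLine false
set_option linter.unusedVariables false
noncomputable section
open scoped Classical

namespace Summit.QuantumAdvantage.QuantumAdvantage.Theorems.OrbitAveraging
open Finset
open Literature.Computability.QuantumComplexity Literature.Computability.QuantumComplexity.RingHLF
open Literature.Computability.MetaComplexity Literature.Computability.MetaComplexity.Smolensky
open Summit.QuantumAdvantage.AdviceFreeQNC0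
open Summit.QuantumAdvantage.QuantumAdvantage.Theorems (flat)
open Summit.QuantumAdvantage.QuantumAdvantage.Theorems.RingPeriodFold (cov covStrat covStrat_mem_lowDeg cov_eq_covStrat)
open Summit.QuantumAdvantage.QuantumAdvantage.Theorems.SpreadBridge (JointStrategy winAllSet sum_card_filter_update
  fibre_decrement decay_le_half)
variable {n : ℕ}

/-- **THE COSET LAW, core count** (uniform rule `cov Q`, index set `S ⊆ [0,M)` nonempty, translate `a`, bit `b`):
`#(odd losses) ≤ n · #(odd losses inside the coset {par S (rot a ·) = b}) + 2^M` — orbit averaging with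
`hull(coset) ⊇ univ ∖ Z` and the triangular count `#Z ≤ 2^M`. -/
theorem coset_core (Q : CubeFn (ZMod 3) n) (S : Finset (Fin n)) (M : ℕ) (hne : S.Nonempty)
    (hS : ∀ j ∈ S, j.val < M) (b : Bool) (a : ℕ) :
    (univ.filter fun x : Fin n → Bool => (OddZeros x ∧ ¬ RingHLF.Rel x (cov Q x))).card ≤
      n * (univ.filter fun x : Fin n → Bool => (OddZeros x ∧ ¬ RingHLF.Rel x (cov Q x)) ∧ par S (rot a x) = b).card + 2 ^ M := by
  have hL : ∀ r : ℕ, ∀ y, (OddZeros (rot r y) ∧ ¬ RingHLF.Rel (rot r y) (cov Q (rot r y))) ↔ (OddZeros y ∧ ¬ RingHLF.Rel y (cov Q y)) := fun r y => oddLoss_rot_iff Q r y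
  -- translate `a ↦ 0`
  have h1 : (univ.filter fun x : Fin n → Bool => (OddZeros x ∧ ¬ RingHLF.Rel x (cov Q x)) ∧ par S (rot a x) = b).card =
      (univ.filter fun x : Fin n → Bool => (OddZeros x ∧ ¬ RingHLF.Rel x (cov Q x)) ∧ par S x = b).card := by
    have h := card_inv_and_rot (fun x : Fin n → Bool => OddZeros x ∧ ¬ RingHLF.Rel x (cov Q x)) (fun x => par S x = b) hL a
    beta_reduce at h
    convert h
  -- orbit averaging
  have h2 : (univ.filter fun y : Fin n → Bool => (OddZeros y ∧ ¬ RingHLF.Rel y (cov Q y)) ∧ ∃ r : Fin n, par S (rot r.val y) = b).card ≤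
      n * (univ.filter fun y : Fin n → Bool => (OddZeros y ∧ ¬ RingHLF.Rel y (cov Q y)) ∧ par S y = b).card := by
    have h := orbit_avg_ge (fun x : Fin n → Bool => OddZeros x ∧ ¬ RingHLF.Rel x (cov Q x)) (fun x => par S x = b) hL
    beta_reduce at h
    convert h
  -- losses outside the hull have ALL translate-parities equal to `!b`
  have h3 : (univ.filter fun x : Fin n → Bool => (OddZeros x ∧ ¬ RingHLF.Rel x (cov Q x))).card ≤
      (univ.filter fun y : Fin n → Bool => (OddZeros y ∧ ¬ RingHLF.Rel y (cov Q y)) ∧ ∃ r : Fin n, par S (rot r.val y) = b).card +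
        (univ.filter fun y : Fin n → Bool => ∀ r : Fin n, par S (rot r.val y) = !b).card := by
    calc (univ.filter fun x : Fin n → Bool => (OddZeros x ∧ ¬ RingHLF.Rel x (cov Q x))).card
        ≤ ((univ.filter fun y : Fin n → Bool => (OddZeros y ∧ ¬ RingHLF.Rel y (cov Q y)) ∧ ∃ r : Fin n, par S (rot r.val y) = b) ∪
            (univ.filter fun y : Fin n → Bool => ∀ r : Fin n, par S (rot r.val y) = !b)).card := by
          refine card_le_card fun x hx => ?_
          rw [mem_filter] at hx
          rw [mem_union, mem_filter, mem_filter]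
          by_cases h : ∃ r : Fin n, par S (rot r.val x) = b
          · exact Or.inl ⟨mem_univ _, hx.2, h⟩
          · exact Or.inr ⟨mem_univ _, fun r => Bool.eq_not_of_ne fun hr => h ⟨r, hr⟩⟩
      _ ≤ _ := card_union_le _ _
  have h4 := card_allShifts_le S M hne hS (!b)
  rw [h1]
  omega

/-- the odd class has at least `2^(n-1)` patterns (`n ≥ 1`; tree `two_pow_le_card_odd`). -/
theorem card_odd_ge (hn : 1 ≤ n) : 2 ^ (n - 1) ≤ (univ.filter fun x : Fin n → Bool => OddZeros x).card := by
  obtain ⟨m, rfl⟩ : ∃ m, n = m + 1 := ⟨n - 1, by omega⟩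
  rw [Nat.add_sub_cancel]
  exact Theorems.ExactnessDialOddToAll.two_pow_le_card_odd

/-- **THE COSET LAW** (the generation-10 atom in the uniform range, EVERY exponent): the junction 26531
(`ExactnessDial.PolyLossOddU3`) gives `(∃ k : ℕ, ∀ c : ℕ, ∃ n₀ : ℕ, ∀ n ≥ n₀, ∀ Q : CubeFn (ZMod 3) n,
  Q ∈ lowDeg (ZMod 3) n ((Nat.log 2 n) ^ c) →
  ∀ S : Finset (Fin n), ∀ M : ℕ, S.Nonempty → (∀ j ∈ S, j.val < M) → M + k * (Nat.log 2 n + 1) ≤ n →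
  ∀ a : ℕ, ∀ b : Bool,
    1 / (n : ℝ) ^ k * (2 : ℝ) ^ n ≤ ((univ.filter fun x : Fin n → Bool =>
      OddZeros x ∧ par S (rot a x) = b ∧ ¬ RingHLF.Rel x (cov Q x)).card : ℝ))` with `k := C + 2`. -/
theorem covSliceLoss_of_polyLossOddU3 (h : Theses.ExactnessDial.PolyLossOddU3) : (∃ k : ℕ, ∀ c : ℕ, ∃ n₀ : ℕ, ∀ n ≥ n₀, ∀ Q : CubeFn (ZMod 3) n,
  Q ∈ lowDeg (ZMod 3) n ((Nat.log 2 n) ^ c) →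
  ∀ S : Finset (Fin n), ∀ M : ℕ, S.Nonempty → (∀ j ∈ S, j.val < M) → M + k * (Nat.log 2 n + 1) ≤ n →
  ∀ a : ℕ, ∀ b : Bool,
    1 / (n : ℝ) ^ k * (2 : ℝ) ^ n ≤ ((univ.filter fun x : Fin n → Bool =>
      OddZeros x ∧ par S (rot a x) = b ∧ ¬ RingHLF.Rel x (cov Q x)).card : ℝ)) := by
  obtain ⟨C, hC⟩ := Theorems.RingSymmetrization3.cov_of_polyLossOddU3 h
  refine ⟨C + 2, fun c => ?_⟩
  obtain ⟨n₀, hn₀⟩ := hC c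
  refine ⟨max n₀ 4, fun n hn Q hQ S M hne hS hM a b => ?_⟩
  have hn₀' : n₀ ≤ n := le_trans (le_max_left _ _) hn
  have hn4 : 4 ≤ n := le_trans (le_max_right _ _) hn
  have hwin := hn₀ n hn₀' Q hQ
  -- counts
  set OW := (univ.filter fun x : Fin n → Bool => OddZeros x ∧ RingHLF.Rel x (cov Q x)).card with hOW
  set OL := (univ.filter fun x : Fin n → Bool => (OddZeros x ∧ ¬ RingHLF.Rel x (cov Q x))).card with hOL
  set T := (univ.filter fun x : Fin n → Bool => (OddZeros x ∧ ¬ RingHLF.Rel x (cov Q x)) ∧ par S (rot a x) = b).card with hT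
  have hsumN : OW + OL = (univ.filter fun x : Fin n → Bool => OddZeros x).card := by
    rw [hOW, hOL, ← card_union_of_disjoint]
    · congr 1
      ext x
      simp only [mem_union, mem_filter, mem_univ, true_and]
      tauto
    · exact disjoint_filter.2 fun x _ h1 h2 => h2.2 h1.2
  have hodd := card_odd_ge (n := n) (by omega)
  have hcore := coset_core Q S M hne hS b a
  have h2M : 2 ^ M * n ^ (C + 2) ≤ 2 ^ n := by
    have hL : n < 2 ^ (Nat.log 2 n + 1) := Nat.lt_pow_succ_log_self (by norm_num) n
    have h1 : n ^ (C + 2) ≤ (2 ^ (Nat.log 2 n + 1)) ^ (C + 2) := Nat.pow_le_pow_left hL.le _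
    rw [← pow_mul] at h1
    calc 2 ^ M * n ^ (C + 2) ≤ 2 ^ M * 2 ^ ((Nat.log 2 n + 1) * (C + 2)) := Nat.mul_le_mul_left _ h1
      _ = 2 ^ (M + (C + 2) * (Nat.log 2 n + 1)) := by rw [← pow_add, Nat.mul_comm]
      _ ≤ 2 ^ n := Nat.pow_le_pow_right (by norm_num) hM
  -- the target filter is `T`
  have hTT : (univ.filter fun x : Fin n → Bool =>
      OddZeros x ∧ par S (rot a x) = b ∧ ¬ RingHLF.Rel x (cov Q x)).card = T := by
    rw [hT]
    exact congrArg Finset.card (filter_congr fun x _ => by tauto)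
  rw [hTT]
  -- real arithmetic
  have hA : (2 : ℝ) ^ n = 2 * (2 : ℝ) ^ (n - 1) := by
    rw [← pow_succ']; congr 1; omega
  set A : ℝ := (2 : ℝ) ^ (n - 1) with hA'
  have hApos : 0 < A := by positivity
  set q : ℝ := (n : ℝ) ^ C with hq
  have hnR : (4 : ℝ) ≤ n := by exact_mod_cast hn4
  have hnpos : (0 : ℝ) < n := by linarith
  have hqpos : 0 < q := by positivity
  have hoddR : A ≤ ((OW : ℝ) + OL) := by
    have : ((2 ^ (n - 1) : ℕ) : ℝ) ≤ ((OW + OL : ℕ) : ℝ) := by rw [hsumN]; exact_mod_cast hodd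
    push_cast at this
    exact this
  have hOLR : A / q ≤ (OL : ℝ) := by
    have e : (1 - 1 / q) * A = A - A / q := by ring
    rw [e] at hwin
    linarith
  have hcoreR : (OL : ℝ) ≤ (n : ℝ) * T + (2 : ℝ) ^ M := by exact_mod_cast hcore
  have h2MR : (2 : ℝ) ^ M * (n : ℝ) ^ (C + 2) ≤ 2 * A := by rw [← hA]; exact_mod_cast h2M
  have hnT : A / q - (2 : ℝ) ^ M ≤ (n : ℝ) * T := by linarith
  have hsmall : (2 : ℝ) ^ M * ((n : ℝ) * q) ≤ 2 * A / n := by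
    rw [le_div_iff₀ hnpos]
    calc (2 : ℝ) ^ M * ((n : ℝ) * q) * n = (2 : ℝ) ^ M * (n : ℝ) ^ (C + 2) := by rw [hq]; ring
      _ ≤ 2 * A := h2MR
  have hhalf : 2 * A / (n : ℝ) ≤ A / 2 := by
    rw [div_le_iff₀ hnpos]
    nlinarith
  rw [hA, div_mul_eq_mul_div, one_mul, div_le_iff₀ (by positivity)]
  calc 2 * A ≤ A * n - 2 * A / n := by nlinarith
    _ ≤ A * n - (2 : ℝ) ^ M * ((n : ℝ) * q) := by linarith
    _ = (A / q - (2 : ℝ) ^ M) * ((n : ℝ) * q) := by field_simp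
    _ ≤ ((n : ℝ) * T) * ((n : ℝ) * q) := mul_le_mul_of_nonneg_right hnT (by positivity)
    _ = (T : ℝ) * (n : ℝ) ^ (C + 2) := by rw [hq]; ring

/-! ## §5 The hybrid lemma in the EQUIVARIANT class (PROVED): `HybridEqv3` -/

/-- **THE HYBRID LEMMA FOR EQUIVARIANT JOINT STRATEGIES** (port of the landed `SpreadBridge.card_winAllSet_le_hybrid`):
for an own-covariant, foreign-invariant joint strategy the fibre victim of the hybrid argument is the UNIFORM rule
`cov Q₀` (`Q₀` = the victim ring's position-`0` output on the fibre) and the fibre's foreign win event has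
rotation-INVARIANT output bits; so a spread hypothesis for uniform victims inside invariant-bit foreign win events
suffices: `#winAll ≤ ((1-η) + η(1-d)^m)·2^(m·n)`. -/
theorem card_winAllSet_le_hybrid_eqv {n m D : ℕ} {η d : ℝ} (hn : 0 < n) (hη1 : η ≤ 1) (hd0 : 0 ≤ d) (hd1 : d ≤ 1)
    (P : JointStrategy m n)
    (hOwn : (∀ (X : Fin m → Fin n → Bool) (j : Fin m) (y : Fin n → Bool) (r : ℕ) (i : Fin n),
      decide (P j i (flat (Function.update X j (rot r y))) = 1) =
        decide (P j (RingSymmetry.shift n r i) (flat (Function.update X j y)) = 1)))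
    (hFor : (∀ (X : Fin m → Fin n → Bool) (j s : Fin m), s ≠ j → ∀ (y : Fin n → Bool) (i : Fin n),
      decide (P s i (flat (Function.update X j (rot 1 y))) = 1) =
        decide (P s i (flat (Function.update X j y)) = 1)))
    (hP : ∀ j i, P j i ∈ lowDeg (ZMod 3) (m * n) D)
    (hS : ∀ Q₀ : CubeFn (ZMod 3) n, Q₀ ∈ lowDeg (ZMod 3) n D →
      ∀ t : ℕ, t < m → ∀ w : Fin t → Fin n → Bool, ∀ F : Fin t → Fin n → CubeFn (ZMod 3) n,
        (∀ s i, F s i ∈ lowDeg (ZMod 3) n D) →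
        (∀ s i y, decide (F s i (rot 1 y) = 1) = decide (F s i y = 1)) →
        (1 - η) * (2 : ℝ) ^ n ≤ ((univ.filter fun y : Fin n → Bool =>
            ∀ s, RingHLF.Rel (w s) (fun i => decide (F s i y = 1))).card : ℝ) →
        d * (2 : ℝ) ^ n ≤ ((univ.filter fun y : Fin n → Bool =>
            (∀ s, RingHLF.Rel (w s) (fun i => decide (F s i y = 1))) ∧
              ¬ RingHLF.Rel y (cov Q₀ y)).card : ℝ)) :
    ((winAllSet P).card : ℝ) ≤ ((1 - η) + η * (1 - d) ^ m) * (2 : ℝ) ^ (m * n) := by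
  classical
  -- sizes
  set N : ℝ := (2 : ℝ) ^ n with hN
  set M : ℝ := (2 : ℝ) ^ (m * n) with hM
  have hNpos : 0 < N := by positivity
  have hN0 : 0 ≤ N := hNpos.le
  have hcardY : (Fintype.card (Fin n → Bool) : ℝ) = N := by
    rw [Fintype.card_fun, Fintype.card_bool, Fintype.card_fin]; push_cast; rfl
  have hcardX : (Fintype.card (Fin m → Fin n → Bool) : ℝ) = M := by
    rw [Fintype.card_fun, Fintype.card_fun, Fintype.card_bool, Fintype.card_fin, Fintype.card_fin]
    push_cast; rw [← pow_mul, mul_comm]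
  -- win predicate of ring `s` and the hybrid sets `A t` (rings `< t` win)
  let Win : Fin m → (Fin m → Fin n → Bool) → Prop := fun s X =>
    RingHLF.Rel (X s) (fun i => decide (P s i (flat X) = 1))
  let A : ℕ → Finset (Fin m → Fin n → Bool) := fun t =>
    univ.filter fun X => ∀ s : Fin m, (s : ℕ) < t → Win s X
  -- one hybrid step
  have hstep : ∀ t : ℕ, t < m →
      ((A (t + 1)).card : ℝ) ≤ (1 - d) * ((A t).card : ℝ) + d * ((1 - η) * M) := by
    intro t ht
    let j : Fin m := ⟨t, ht⟩
    have hupd_ne : ∀ (X : Fin m → Fin n → Bool) (y : Fin n → Bool) (s : Fin m), (s : ℕ) < t →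
        Function.update X j y s = X s := by
      intro X y s hs
      apply Function.update_of_ne
      intro hsj
      rw [hsj] at hs
      exact lt_irrefl _ hs
    -- fibrewise bound
    have hfib : ∀ X : Fin m → Fin n → Bool,
        ((univ.filter fun y : Fin n → Bool =>
            ∀ s : Fin m, (s : ℕ) < t + 1 → Win s (Function.update X j y)).card : ℝ)
          ≤ (1 - d) * ((univ.filter fun y : Fin n → Bool =>
            ∀ s : Fin m, (s : ℕ) < t → Win s (Function.update X j y)).card : ℝ) + d * ((1 - η) * N) := by
      intro X
      -- the substitution `y ↦ flat (update X j y)` fixes every coordinate outside ring `j`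
      let emb : (Fin n → Bool) → (Fin (m * n) → Bool) := fun y => flat (Function.update X j y)
      have hemb : ∀ kk, (∃ b, ∀ u, emb u kk = b) ∨ (∃ s, ∀ u, emb u kk = u s) := by
        intro kk
        simp only [emb, flat]
        generalize finProdFinEquiv.symm kk = q
        obtain ⟨r, s⟩ := q
        by_cases hr : r = j
        · right
          refine ⟨s, fun u => ?_⟩
          rw [hr, Function.update_self]
        · left
          refine ⟨X r s, fun u => ?_⟩
          rw [Function.update_of_ne hr]
      let Pv : Fin n → CubeFn (ZMod 3) n := fun i y => P j i (emb y)
      have hPv : ∀ i, Pv i ∈ lowDeg (ZMod 3) n D := fun i =>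
        Smolensky.comp_subst_mem_lowDeg emb hemb (hP j i)
      -- EQUIVARIANCE (own ring): the fibre victim is the UNIFORM rule generated by its position-0 output
      let Q₀ : CubeFn (ZMod 3) n := Pv ⟨0, hn⟩
      have hQ₀ : Q₀ ∈ lowDeg (ZMod 3) n D := hPv ⟨0, hn⟩
      have hbits : ∀ y : Fin n → Bool, (fun i => decide (Pv i y = 1)) = cov Q₀ y := by
        intro y
        funext i
        have h1 := hOwn X j y i.val ⟨0, hn⟩
        have hsh : RingSymmetry.shift n i.val ⟨0, hn⟩ = i := by
          apply Fin.ext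
          show (0 + i.val) % n = i.val
          rw [Nat.zero_add, Nat.mod_eq_of_lt i.isLt]
        rw [hsh] at h1
        exact h1.symm
      let w : Fin t → Fin n → Bool := fun s => X ⟨s, lt_trans s.isLt ht⟩
      let Q : Fin t → Fin n → CubeFn (ZMod 3) n := fun s i y => P ⟨s, lt_trans s.isLt ht⟩ i (emb y)
      have hQ : ∀ s i, Q s i ∈ lowDeg (ZMod 3) n D := fun s i =>
        Smolensky.comp_subst_mem_lowDeg emb hemb (hP _ i)
      -- EQUIVARIANCE (foreign rings): the processed rings' output bits are invariant under rotating the fibre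
      have hQinv : ∀ s i y, decide (Q s i (rot 1 y) = 1) = decide (Q s i y = 1) := by
        intro s i y
        have hsj : (⟨s, lt_trans s.isLt ht⟩ : Fin m) ≠ j := by
          intro h
          have h' := congrArg Fin.val h
          exact absurd h' (ne_of_lt s.isLt)
        exact hFor X j ⟨s, lt_trans s.isLt ht⟩ hsj y i
      -- the foreign win event of the processed rings on this fibre
      set E := univ.filter fun y : Fin n → Bool =>
        ∀ s : Fin t, RingHLF.Rel (w s) (fun i => decide (Q s i y = 1)) with hEdef
      have hE : (univ.filter fun y : Fin n → Bool =>
          ∀ s : Fin m, (s : ℕ) < t → Win s (Function.update X j y)) = E := by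
        ext y
        simp only [hEdef, mem_filter, mem_univ, true_and]
        constructor
        · intro hy s
          have h1 := hy ⟨s, lt_trans s.isLt ht⟩ s.isLt
          simp only [Win, hupd_ne X y ⟨s, lt_trans s.isLt ht⟩ s.isLt] at h1
          exact h1
        · intro hy s hs
          have h1 := hy ⟨s, hs⟩
          simp only [Win, hupd_ne X y s hs]
          exact h1
      have hEW : (univ.filter fun y : Fin n → Bool =>
          ∀ s : Fin m, (s : ℕ) < t + 1 → Win s (Function.update X j y))
          = E.filter fun y => RingHLF.Rel y (fun i => decide (Pv i y = 1)) := by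
        ext y
        simp only [hEdef, mem_filter, mem_univ, true_and]
        constructor
        · intro hy
          refine ⟨fun s => ?_, ?_⟩
          · have h1 := hy ⟨s, lt_trans s.isLt ht⟩ (Nat.lt_succ_of_lt s.isLt)
            simp only [Win, hupd_ne X y ⟨s, lt_trans s.isLt ht⟩ s.isLt] at h1
            exact h1
          · have h1 := hy j (Nat.lt_succ_self t)
            simp only [Win, Function.update_self] at h1
            exact h1
        · rintro ⟨hy1, hy2⟩ s hs
          rcases Nat.lt_succ_iff_lt_or_eq.mp hs with hs' | hs'
          · have h1 := hy1 ⟨s, hs'⟩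
            simp only [Win, hupd_ne X y s hs']
            exact h1
          · have hsj : s = j := Fin.ext hs'
            rw [hsj]
            simp only [Win, Function.update_self]
            exact hy2
      -- counts on the fibre
      have hsplit := Finset.card_filter_add_card_filter_not (s := E)
        (fun y : Fin n → Bool => RingHLF.Rel y (fun i => decide (Pv i y = 1)))
      have hsum : ((E.filter fun y : Fin n → Bool => RingHLF.Rel y (fun i => decide (Pv i y = 1))).card : ℝ)
          + ((E.filter fun y : Fin n → Bool => ¬ RingHLF.Rel y (fun i => decide (Pv i y = 1))).card : ℝ)
            = (E.card : ℝ) := by exact_mod_cast hsplit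
      have heN : (E.card : ℝ) ≤ N := by
        rw [← hcardY]; exact_mod_cast Finset.card_le_univ E
      have hsp : (1 - η) * N ≤ (E.card : ℝ) →
          d * N ≤ ((E.filter fun y : Fin n → Bool => ¬ RingHLF.Rel y (fun i => decide (Pv i y = 1))).card : ℝ) := by
        intro hle
        have h1 := hS Q₀ hQ₀ t ht w Q hQ hQinv (by rw [hEdef] at hle; exact hle)
        have hset : (E.filter fun y : Fin n → Bool => ¬ RingHLF.Rel y (fun i => decide (Pv i y = 1))) =
            univ.filter fun y : Fin n → Bool =>
              (∀ s, RingHLF.Rel (w s) (fun i => decide (Q s i y = 1))) ∧ ¬ RingHLF.Rel y (cov Q₀ y) := by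
          ext y
          simp only [hEdef, mem_filter, mem_univ, true_and, hbits]
        rw [hset]
        exact h1
      rw [hEW, hE]
      exact fibre_decrement hsum heN (by positivity) hN0 hd0 hη1 hsp
    -- sum the fibrewise bound over all tuples
    have hL : ∑ X : Fin m → Fin n → Bool, ((univ.filter fun y : Fin n → Bool =>
          ∀ s : Fin m, (s : ℕ) < t + 1 → Win s (Function.update X j y)).card : ℝ)
        = N * ((A (t + 1)).card : ℝ) := by
      have h1 := sum_card_filter_update j (fun Z : Fin m → Fin n → Bool => ∀ s : Fin m, (s : ℕ) < t + 1 → Win s Z)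
      rw [← hcardY]
      exact_mod_cast h1
    have hR : ∑ X : Fin m → Fin n → Bool, ((univ.filter fun y : Fin n → Bool =>
          ∀ s : Fin m, (s : ℕ) < t → Win s (Function.update X j y)).card : ℝ)
        = N * ((A t).card : ℝ) := by
      have h1 := sum_card_filter_update j (fun Z : Fin m → Fin n → Bool => ∀ s : Fin m, (s : ℕ) < t → Win s Z)
      rw [← hcardY]
      exact_mod_cast h1
    have hsumle : N * ((A (t + 1)).card : ℝ)
        ≤ (1 - d) * (N * ((A t).card : ℝ)) + M * (d * ((1 - η) * N)) := by
      rw [← hL, ← hR, Finset.mul_sum, ← hcardX, ← Finset.card_univ, ← nsmul_eq_mul, ← Finset.sum_const,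
        ← Finset.sum_add_distrib]
      exact Finset.sum_le_sum fun X _ => hfib X
    -- divide by N
    have hkey : N * ((A (t + 1)).card : ℝ) ≤ N * ((1 - d) * ((A t).card : ℝ) + d * ((1 - η) * M)) := by
      calc N * ((A (t + 1)).card : ℝ) ≤ (1 - d) * (N * ((A t).card : ℝ)) + M * (d * ((1 - η) * N)) := hsumle
        _ = N * ((1 - d) * ((A t).card : ℝ) + d * ((1 - η) * M)) := by ring
    exact le_of_mul_le_mul_left hkey hNpos
  -- iterate
  have hind : ∀ t : ℕ, t ≤ m → ((A t).card : ℝ) ≤ ((1 - η) + η * (1 - d) ^ t) * M := by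
    intro t
    induction t with
    | zero =>
      intro _
      have hA0 : A 0 = univ := by
        ext X
        simp [A]
      rw [hA0, Finset.card_univ, hcardX]
      ring_nf
      exact le_rfl
    | succ t ih =>
      intro ht
      have ht' : t < m := Nat.lt_of_succ_le ht
      have h1d : 0 ≤ 1 - d := by linarith
      calc ((A (t + 1)).card : ℝ) ≤ (1 - d) * ((A t).card : ℝ) + d * ((1 - η) * M) := hstep t ht'
        _ ≤ (1 - d) * (((1 - η) + η * (1 - d) ^ t) * M) + d * ((1 - η) * M) :=
            add_le_add (mul_le_mul_of_nonneg_left (ih ht'.le) h1d) le_rfl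
        _ = ((1 - η) + η * (1 - d) ^ (t + 1)) * M := by ring
  have hAm : winAllSet P = A m := by
    ext X
    simp only [winAllSet, A, Win, mem_filter, mem_univ, true_and]
    exact ⟨fun h s _ => h s, fun h s => h s s.isLt⟩
  rw [hAm]
  exact hind m le_rfl


end Summit.QuantumAdvantage.QuantumAdvantage.Theorems.OrbitAveraging
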